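import Mathlib.Topology.Algebra.Group.Basic
import Mathlib.Topology.Connected.Basic
import Mathlib.GroupTheory.Subgroup.Center
import HarnessLib

/-!
# Crux `NonSimplyConnectedLatticeGap` (stmt-QuantumFields-16405), route `ConvexGribovBody`, line `Sketch` —
# stub `stub_normalClause_map` (I3: the simplicity clause descends along a covering-type homomorphism)

Skeleton line `Sketch` v3 of the crux
`Summit.QuantumFields.YangMills.Theses.ConvexGribovBody.NonSimplyConnectedLatticeGap` certifies the first
admissible instance `G = SO(3) = S³/{±1}` of the crux's hypothesis class (compact simple gauge groups with
`π₁(G) ≠ 0`). The "simplicity clause" of `IsSimpleCompactGroup` (every closed preconnected normal subgroup is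
`⊥` or `⊤`) is known for `SU(2) ≅ S³` and has to be pushed down the `2 : 1` covering homomorphism
`rotHom : S³ →* SO(3)`, whose kernel `{±1}` contains the centre. This file proves the registered side-stub I3, the
transfer in general form, a purely topological-group-theoretic lemma:

* `stub_normalClause_map` — let `G` be a connected topological group in which every closed preconnected normal
  subgroup is `⊥` or `⊤`, and `f : G →* H` a continuous surjective homomorphism with `center G ≤ ker f`; then every
  closed preconnected normal subgroup `N` of `H` is `⊥` or `⊤`.

Proof. Put `N' := f⁻¹ N` (closed, normal) and let `N₀` be the connected component of `1` in `N'`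
(`connectedComponentIn ↑N' 1`): a closed preconnected normal subgroup of `G` (lemmas `identityComponentIn_*`,
all instances of one absorption principle `identityComponentIn_absorb`: a preconnected subset of `N'` meeting the
component lies in it), hence `⊥` or `⊤`. If `N₀ = ⊤` then `N' = ⊤` and `N = f(N') = ⊤` by surjectivity. If
`N₀ = ⊥` then for `n ∈ N'` the commutator orbit `{k n k⁻¹ n⁻¹ | k ∈ G}` is preconnected (`G` is connected), lies
in `N'` and contains `1`, so it lies in `N₀ = {1}`: `n` is central, hence `f n = 1`; by surjectivity `N = ⊥`.
(Preconnectedness of `N` is not needed.)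

Helper lemmas are prefixed `identityComponentIn_`. No named unproved facts are used; Mathlib only.
-/

set_option autoImplicit false

namespace Summit.QuantumFields.YangMills.Theorems.NonSimplyConnectedLatticeGap

/-- **Absorption principle for connected components in a set**: a preconnected `S ⊆ F` that meets
`connectedComponentIn F x` is contained in it. [folklore] -/
theorem identityComponentIn_absorb {α : Type*} [TopologicalSpace α] {F S : Set α} {x y : α}
    (hS : IsPreconnected S) (hSF : S ⊆ F) (hyS : y ∈ S) (hy : y ∈ connectedComponentIn F x) :
    S ⊆ connectedComponentIn F x := by
  rw [connectedComponentIn_eq hy]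
  exact hS.subset_connectedComponentIn hyS hSF

/-- The connected component of `1` in (the carrier of) a subgroup `K` of a topological group is closed under
multiplication: `a • N₀` is preconnected, lies in `K` and contains `a ∈ N₀`. [folklore] -/
theorem identityComponentIn_mul_mem {G : Type*} [Group G] [TopologicalSpace G] [IsTopologicalGroup G]
    (K : Subgroup G) {a b : G} (ha : a ∈ connectedComponentIn (K : Set G) 1)
    (hb : b ∈ connectedComponentIn (K : Set G) 1) :
    a * b ∈ connectedComponentIn (K : Set G) 1 := by
  have hKa : a ∈ K := connectedComponentIn_subset _ _ ha
  have h1 : (1 : G) ∈ connectedComponentIn (K : Set G) 1 := mem_connectedComponentIn K.one_mem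
  have hsub : (fun x => a * x) '' connectedComponentIn (K : Set G) 1 ⊆
      connectedComponentIn (K : Set G) 1 :=
    identityComponentIn_absorb
      (isPreconnected_connectedComponentIn.image _ (continuous_const_mul a).continuousOn)
      (by
        rintro _ ⟨c, hc, rfl⟩
        exact K.mul_mem hKa (connectedComponentIn_subset _ _ hc))
      ⟨1, h1, mul_one a⟩ ha
  exact hsub (Set.mem_image_of_mem _ hb)

/-- The connected component of `1` in a subgroup `K` of a topological group is closed under inversion:
`a⁻¹ • N₀` is preconnected, lies in `K` and contains `1 = a⁻¹ a ∈ N₀`, so `a⁻¹ = a⁻¹ · 1 ∈ N₀`. [folklore] -/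
theorem identityComponentIn_inv_mem {G : Type*} [Group G] [TopologicalSpace G] [IsTopologicalGroup G]
    (K : Subgroup G) {a : G} (ha : a ∈ connectedComponentIn (K : Set G) 1) :
    a⁻¹ ∈ connectedComponentIn (K : Set G) 1 := by
  have hKa : a ∈ K := connectedComponentIn_subset _ _ ha
  have h1 : (1 : G) ∈ connectedComponentIn (K : Set G) 1 := mem_connectedComponentIn K.one_mem
  have hsub : (fun x => a⁻¹ * x) '' connectedComponentIn (K : Set G) 1 ⊆
      connectedComponentIn (K : Set G) 1 :=
    identityComponentIn_absorb
      (isPreconnected_connectedComponentIn.image _ (continuous_const_mul a⁻¹).continuousOn)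
      (by
        rintro _ ⟨c, hc, rfl⟩
        exact K.mul_mem (K.inv_mem hKa) (connectedComponentIn_subset _ _ hc))
      ⟨a, ha, inv_mul_cancel a⟩ h1
  simpa using hsub (Set.mem_image_of_mem _ h1)

/-- The connected component of `1` in a normal subgroup `K` of a topological group is invariant under
conjugation: `g N₀ g⁻¹` is preconnected, lies in `K` and contains `1`. [folklore] -/
theorem identityComponentIn_conj_mem {G : Type*} [Group G] [TopologicalSpace G] [IsTopologicalGroup G]
    (K : Subgroup G) (hK : K.Normal) (g : G) {a : G} (ha : a ∈ connectedComponentIn (K : Set G) 1) :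
    g * a * g⁻¹ ∈ connectedComponentIn (K : Set G) 1 := by
  have h1 : (1 : G) ∈ connectedComponentIn (K : Set G) 1 := mem_connectedComponentIn K.one_mem
  have hsub : (fun x => g * x * g⁻¹) '' connectedComponentIn (K : Set G) 1 ⊆
      connectedComponentIn (K : Set G) 1 :=
    identityComponentIn_absorb
      (isPreconnected_connectedComponentIn.image _ (IsTopologicalGroup.continuous_conj g).continuousOn)
      (by
        rintro _ ⟨c, hc, rfl⟩
        exact hK.conj_mem c (connectedComponentIn_subset _ _ hc) g)
      ⟨1, h1, by simp⟩ h1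
  exact hsub (Set.mem_image_of_mem _ ha)

/-- The connected component of `1` in a closed subgroup `K` (indeed in any closed set containing `1`) is closed:
its closure is preconnected, lies in `K` and contains `1`. [folklore] -/
theorem identityComponentIn_isClosed {G : Type*} [Group G] [TopologicalSpace G]
    (K : Subgroup G) (hK : IsClosed (K : Set G)) :
    IsClosed (connectedComponentIn (K : Set G) 1) := by
  have h1 : (1 : G) ∈ connectedComponentIn (K : Set G) 1 := mem_connectedComponentIn K.one_mem
  exact closure_subset_iff_isClosed.mp
    (identityComponentIn_absorb isPreconnected_connectedComponentIn.closure
      (closure_minimal (connectedComponentIn_subset _ _) hK) (subset_closure h1) h1)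

/-- **In a connected topological group, a normal subgroup whose identity component (taken inside the subgroup)
is trivial is central**: the commutator orbit `{k n k⁻¹ n⁻¹ | k}` of `n ∈ K` is preconnected, lies in `K` and
contains `1`, hence lies in the component `{1}`. [folklore] -/
theorem identityComponentIn_le_center_of_eq_singleton {G : Type*} [Group G] [TopologicalSpace G]
    [IsTopologicalGroup G] [PreconnectedSpace G] (K : Subgroup G) (hK : K.Normal)
    (h1 : connectedComponentIn (K : Set G) 1 = {1}) : K ≤ Subgroup.center G := by
  intro n hn
  rw [Subgroup.mem_center_iff]
  intro k
  have h1mem : (1 : G) ∈ connectedComponentIn (K : Set G) 1 := mem_connectedComponentIn K.one_mem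
  have hS : Set.range (fun k : G => k * n * k⁻¹ * n⁻¹) ⊆ connectedComponentIn (K : Set G) 1 :=
    identityComponentIn_absorb (isPreconnected_range (by fun_prop))
      (by
        rintro _ ⟨k, rfl⟩
        exact K.mul_mem (hK.conj_mem n hn k) (K.inv_mem hn))
      ⟨1, by simp⟩ h1mem
  have hk : k * n * k⁻¹ * n⁻¹ = 1 := by
    have hmem := hS (Set.mem_range_self k)
    rw [h1] at hmem
    exact hmem
  exact mul_inv_eq_iff_eq_mul.mp (mul_inv_eq_one.mp hk)

/-- **STUB I3 — the simplicity clause descends along a continuous surjective homomorphism killing the centre.**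
If `G` is a connected topological group in which every closed preconnected normal subgroup is `⊥` or `⊤`, and
`f : G →* H` is a continuous surjective homomorphism whose kernel contains the centre of `G`, then every closed
preconnected normal subgroup of `H` is `⊥` or `⊤`. (For such `N ≤ H` let `N' = f⁻¹ N` (closed, normal) and `N₀`
the connected component of `1` in `N'` — a closed preconnected normal subgroup of `G`, hence `⊥` or `⊤`; if `⊤`
then `N = ⊤`; if `⊥` then every `n ∈ N'` is central, so `f n = 1`, so `N = ⊥`.) [folklore] -/
theorem stub_normalClause_map :
    ∀ (G H : Type) [Group G] [TopologicalSpace G] [IsTopologicalGroup G] [ConnectedSpace G]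
      [Group H] [TopologicalSpace H] (f : G →* H),
      Continuous f → Function.Surjective f → Subgroup.center G ≤ f.ker →
      (∀ N : Subgroup G, N.Normal → IsClosed (N : Set G) → IsPreconnected (N : Set G) → N = ⊥ ∨ N = ⊤) →
      ∀ N : Subgroup H, N.Normal → IsClosed (N : Set H) → IsPreconnected (N : Set H) → N = ⊥ ∨ N = ⊤ := by
  intro G H _ _ _ _ _ _ f hf hsurj hker hG N hN hc _
  -- the pull-back `N' = f⁻¹ N`: normal and closed
  have hN'n : (N.comap f).Normal := hN.comap f
  have hN'c : IsClosed ((N.comap f : Subgroup G) : Set G) := hc.preimage hf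
  -- its identity component `N₀`, as a subgroup of `G`
  obtain ⟨N₀, hN₀⟩ : ∃ N₀ : Subgroup G,
      (N₀ : Set G) = connectedComponentIn ((N.comap f : Subgroup G) : Set G) 1 :=
    ⟨{ carrier := connectedComponentIn ((N.comap f : Subgroup G) : Set G) 1
       one_mem' := mem_connectedComponentIn (N.comap f).one_mem
       mul_mem' := fun ha hb => identityComponentIn_mul_mem (N.comap f) ha hb
       inv_mem' := fun ha => identityComponentIn_inv_mem (N.comap f) ha }, rfl⟩
  have hmem : ∀ x : G, x ∈ N₀ ↔ x ∈ connectedComponentIn ((N.comap f : Subgroup G) : Set G) 1 :=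
    fun x => by rw [← SetLike.mem_coe, hN₀]
  have hN₀n : N₀.Normal :=
    ⟨fun a ha g => (hmem _).2 (identityComponentIn_conj_mem (N.comap f) hN'n g ((hmem a).1 ha))⟩
  have hN₀c : IsClosed (N₀ : Set G) := by
    rw [hN₀]
    exact identityComponentIn_isClosed (N.comap f) hN'c
  have hN₀p : IsPreconnected (N₀ : Set G) := by
    rw [hN₀]
    exact isPreconnected_connectedComponentIn
  rcases hG N₀ hN₀n hN₀c hN₀p with h0 | h0
  · -- `N₀ = ⊥`: `N'` is central, hence killed by `f`, hence `N = f(N') = ⊥`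
    left
    have h1 : connectedComponentIn ((N.comap f : Subgroup G) : Set G) 1 = {1} := by
      rw [← hN₀, h0]
      exact Subgroup.coe_bot
    have hcen : N.comap f ≤ Subgroup.center G :=
      identityComponentIn_le_center_of_eq_singleton (N.comap f) hN'n h1
    rw [Subgroup.eq_bot_iff_forall]
    intro x hx
    obtain ⟨g, rfl⟩ := hsurj x
    have hg : g ∈ N.comap f := hx
    exact (MonoidHom.mem_ker).1 (hker (hcen hg))
  · -- `N₀ = ⊤`: `N' = ⊤`, hence `N = f(N') = ⊤`
    right
    rw [Subgroup.eq_top_iff']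
    intro x
    obtain ⟨g, rfl⟩ := hsurj x
    have hg : g ∈ connectedComponentIn ((N.comap f : Subgroup G) : Set G) 1 := by
      rw [← hN₀, h0]
      exact Set.mem_univ g
    have hg' : g ∈ N.comap f := connectedComponentIn_subset _ _ hg
    exact hg'

end Summit.QuantumFields.YangMills.Theorems.NonSimplyConnectedLatticeGap
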